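import Summits.NavierStokesRegularity.NavierStokesRegularity.Theorems.AxisymmetricExtremalityAxisymmetricKatoGlobalStubSeregin2020TypeIILemma22SublevelEnergyTools
import Literature.Analysis.FluidPDE.KNSSSwirlTransport
import HarnessLib

/-!
# Seregin 2020, Lemma 2.2 (after Nazarov–Uraltseva 2012): the energy bound (3.12) on sublevel
# sets from the energy-inequality class in its canonical SPLIT form

Helper toward the stub `stub_seregin2020TypeII` of the crux `AxisymmetricKatoGlobal` (= the named
fact `Literature.Analysis.FluidPDE.Seregin2020_axisymmetricSingularPoint_typeII`, Seregin 2020,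
Thm 2.1), reduced in the tree to `hWH′` (= N–U 2012 Lemma 4.2 for the class 𝒱). Split-form twin
of the sibling `…Lemma22SublevelEnergy`: the hypothesis `hEC` is the energy class EXACTLY as in
the registered stubs `lemma22_*` of stmt-15453 / skeleton v3 of
`Cruxes/AxisymmetricKatoGlobal/Seregin2020Lemma22ExpansionOfPositivity.lean` — slice integral
parenthesised, the four right-hand terms as SEPARATE Bochner integrals — so that the atoms typed
against the registry can use it verbatim. Each of the four integrals is bounded through
`‖∫ T‖ ≤ ∫⁻ ‖T‖` and a pointwise majorant living on `B̄(ρ₁)`.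

* `lintegral_fderiv_sq_sublevel_le_of_energyClass'` — for `0 < ρ < ρ₁ < 2R`, `-R² < a < t₀ ≤ 0`,
  `0 < l`, `2l ≤ k`: `∫∫_{(]a,t₀[ × B(ρ)) ∩ {Φ < l}} ‖∇Φ‖² ≤ (8/3) l² (|B̄(ρ₁)|
  + 4 (C_g/(ρ₁-ρ))² (t₀-a)|B̄(ρ₁)| + 2 (C_g/(ρ₁-ρ)) I_U + 4 (C_g/(ρ₁-ρ)) I_ϱ)`.

## References

* A. I. Nazarov, N. N. Uraltseva, St. Petersburg Math. J. 23 (2012) 93–115 = arXiv:1011.1888,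
  §3, (3.9), (3.12), Remark 9. [NazarovUraltseva2012]
* G. Seregin, Anal. Math. Phys. 10 (2020), Paper 46 = arXiv:2006.04140, Lemma 2.2. [Seregin2020]
-/


-- the problem directory repeats the summit name (D-0017); core's `dupNamespace` linter fires
set_option linter.dupNamespace false

noncomputable section

open MeasureTheory Set Function Filter Topology Metric Module
open scoped NNReal ENNReal

namespace Summit.NavierStokesRegularity.NavierStokesRegularity.Theorems.AxisymmetricKatoGlobal.EulerScaling

open Literature.Analysis.FluidPDE Literature.Analysis.FluidPDE.LeiZhang2011

/-! ### The energy bound (3.12) on sublevel sets -/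

/-- **Nazarov–Uraltseva 2012, (3.12) from the energy class (Seregin's class 𝒱, Remark 9).**
Let `Φ ≥ 0` be jointly measurable, `U` a.e.-strongly measurable on the slab
`]-R², 0[ × B(2R)`, and assume the ENERGY-INEQUALITY CLASS at the axis level `k` on that slab
(hypothesis `hEC`, = `EnergyClass Φ U k R` of the cell's De Giorgi skeleton, written out).
Let `0 < ρ < ρ₁ < 2R`, `-R² < a < t₀ ≤ 0`, `0 < l` with `2l ≤ k`, let `C_g/(ρ₁ - ρ)` bound the
gradient of the radial cut-off `Θ = radialCutoff ρ ρ₁`, and let `I_U`, `I_ϱ` be finite bounds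
of `∫∫_{[a,t₀[ × B̄(ρ₁)} |U|` and `∫∫_{[a,t₀[ × B̄(ρ₁)} 1/ϱ`. Then
`∫∫_{(]a,t₀[ × B(ρ)) ∩ {Φ < l}} ‖∇Φ‖² ≤ (8/3) l² (|B̄(ρ₁)| + 4 (C_g/(ρ₁-ρ))² (t₀ - a)|B̄(ρ₁)|
  + 2 (C_g/(ρ₁-ρ)) I_U + 4 (C_g/(ρ₁-ρ)) I_ϱ)`
(test the class with `H = ((2l-τ)₊)³`, `η ≡ 1`, `Θ`; on `B(ρ) ∩ {Φ < l}` the dissipation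
density is `≥ 3l |∇Φ|²`; the right-hand side is bounded through `H ≤ 8l³`, `|∇Θ| ≤ C_g/(ρ₁-ρ)`,
`|Θ| ≤ 1`, `|e_ϱ| ≤ 1`; finally `t₂ ↑ t₀`).
[cite: NazarovUraltseva2012, §3 (3.9), (3.12), Remark 9; Seregin2020, Lemma 2.2] -/
theorem lintegral_fderiv_sq_sublevel_le_of_energyClass'
    (Φ : ℝ → EuclideanSpace ℝ (Fin 3) → ℝ)
    (U : ℝ → EuclideanSpace ℝ (Fin 3) → EuclideanSpace ℝ (Fin 3)) (k R : ℝ)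
    (hΦm : Measurable (uncurry Φ)) (hΦ0 : ∀ t x, 0 ≤ Φ t x)
    (hU : AEStronglyMeasurable (uncurry U)
      (volume.restrict (Ioo (-R ^ 2) 0 ×ˢ ball (0 : EuclideanSpace ℝ (Fin 3)) (2 * R))))
    (hEC : ∀ (H : ℝ → ℝ), ContDiff ℝ 2 H → (∀ v, deriv H v ≤ 0) → (∀ v, 0 ≤ H v) →
      (∀ v, 0 ≤ deriv (deriv H) v) → (∀ v, deriv H v ^ 2 ≤ 2 * H v * deriv (deriv H) v) →
      (∀ v, k ≤ v → H v = 0) →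
      ∀ (Θ : EuclideanSpace ℝ (Fin 3) → ℝ), ContDiff ℝ 1 Θ → HasCompactSupport Θ →
        tsupport Θ ⊆ ball (0 : EuclideanSpace ℝ (Fin 3)) (2 * R) →
      ∀ (η : ℝ → ℝ), ContDiff ℝ 1 η → (∀ s, 0 ≤ η s) →
      ∀ (t₁ t₂ : ℝ), -R ^ 2 < t₁ → t₁ ≤ t₂ → t₂ < 0 →
        ENNReal.ofReal (η t₂ * ∫ x, H (Φ t₂ x) * Θ x ^ 2) +
          ∫⁻ z in Icc t₁ t₂ ×ˢ (univ : Set (EuclideanSpace ℝ (Fin 3))), ENNReal.ofReal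
            (1 / 2 * η z.1 * (deriv (deriv H) (Φ z.1 z.2) * ‖gradient (Φ z.1) z.2‖ ^ 2 *
              Θ z.2 ^ 2))
        ≤ ENNReal.ofReal (η t₁ * (∫ x, H (Φ t₁ x) * Θ x ^ 2) +
            (4 * ∫ z in Icc t₁ t₂ ×ˢ (univ : Set (EuclideanSpace ℝ (Fin 3))),
              η z.1 * (H (Φ z.1 z.2) * ‖gradient Θ z.2‖ ^ 2)) +
            (∫ z in Icc t₁ t₂ ×ˢ (univ : Set (EuclideanSpace ℝ (Fin 3))),
              η z.1 * (H (Φ z.1 z.2) * inner ℝ (U z.1 z.2) (gradient (fun y => Θ y ^ 2) z.2))) +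
            (∫ z in Icc t₁ t₂ ×ˢ (univ : Set (EuclideanSpace ℝ (Fin 3))),
              η z.1 * (2 / cylRadius z.2 *
                (H (Φ z.1 z.2) * fderiv ℝ (fun y => Θ y ^ 2) z.2 (eR z.2)))) +
            (∫ z in Icc t₁ t₂ ×ˢ (univ : Set (EuclideanSpace ℝ (Fin 3))),
              |deriv η z.1| * (H (Φ z.1 z.2) * Θ z.2 ^ 2))))
    {ρ ρ₁ a t₀ l : ℝ} (hρ : 0 < ρ) (hρ₁ : ρ < ρ₁) (hρ₁R : ρ₁ < 2 * R) (ha : -R ^ 2 < a)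
    (hat : a < t₀) (ht₀ : t₀ ≤ 0) (hl : 0 < l) (hlk : 2 * l ≤ k)
    {Cg : ℝ} (hCg0 : 0 ≤ Cg)
    (hCg : ∀ x, ‖fderiv ℝ (radialCutoff ρ ρ₁ : EuclideanSpace ℝ (Fin 3) → ℝ) x‖ ≤ Cg / (ρ₁ - ρ))
    {IU Iϱ : ℝ≥0∞} (hIUfin : IU ≠ ∞) (hIϱfin : Iϱ ≠ ∞)
    (hIU : ∫⁻ z in Ico a t₀ ×ˢ closedBall (0 : EuclideanSpace ℝ (Fin 3)) ρ₁, ‖U z.1 z.2‖ₑ ≤ IU)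
    (hIϱ : ∫⁻ z in Ico a t₀ ×ˢ closedBall (0 : EuclideanSpace ℝ (Fin 3)) ρ₁,
      ENNReal.ofReal (cylRadius z.2)⁻¹ ≤ Iϱ) :
    ∫⁻ z in (Ioo a t₀ ×ˢ ball (0 : EuclideanSpace ℝ (Fin 3)) ρ) ∩ {z | Φ z.1 z.2 < l},
        ‖fderiv ℝ (Φ z.1) z.2‖ₑ ^ 2 ≤
      ENNReal.ofReal (8 / 3 * l ^ 2 *
        ((volume (closedBall (0 : EuclideanSpace ℝ (Fin 3)) ρ₁)).toReal +
          4 * (Cg / (ρ₁ - ρ)) ^ 2 * ((t₀ - a) *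
            (volume (closedBall (0 : EuclideanSpace ℝ (Fin 3)) ρ₁)).toReal) +
          2 * (Cg / (ρ₁ - ρ)) * IU.toReal + 4 * (Cg / (ρ₁ - ρ)) * Iϱ.toReal)) := by
  set K : Set (EuclideanSpace ℝ (Fin 3)) := closedBall (0 : EuclideanSpace ℝ (Fin 3)) ρ₁ with hK
  set VK : ℝ := (volume K).toReal with hVK
  set A : ℝ := Cg / (ρ₁ - ρ) with hA
  have hρ₁pos : 0 < ρ₁ := hρ.trans hρ₁
  have hA0 : 0 ≤ A := by rw [hA]; exact div_nonneg hCg0 (by linarith)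
  have hKm : MeasurableSet K := measurableSet_closedBall
  have hKfin : volume K < ∞ := measure_closedBall_lt_top
  have hta : 0 < t₀ - a := by linarith
  set H : ℝ → ℝ := fun τ => max (2 * l - τ) 0 ^ (3 : ℝ) with hH
  obtain ⟨hH2, hH', hH0, hH'', hHsq, hH2l, hH8, hH6⟩ := cubeProfile_props hl
  have hHk : ∀ v, k ≤ v → H v = 0 := fun v hv => hH2l v (hlk.trans hv)
  obtain ⟨hΘ1, hΘc, hΘK, hΘ01, hΘone, hΘzero⟩ := radialCutoff_energy_props hρ hρ₁
  set Θ : EuclideanSpace ℝ (Fin 3) → ℝ := radialCutoff ρ ρ₁ with hΘ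
  have hΘsupp : tsupport Θ ⊆ ball (0 : EuclideanSpace ℝ (Fin 3)) (2 * R) :=
    hΘK.trans (closedBall_subset_ball hρ₁R)
  have hΘA : ∀ x, ‖fderiv ℝ Θ x‖ ≤ A := hCg
  set η : ℝ → ℝ := fun _ => 1 with hη
  have hη1 : ContDiff ℝ 1 η := contDiff_const
  have hη0 : ∀ s, 0 ≤ η s := fun _ => zero_le_one
  set T₁ : ℝ × EuclideanSpace ℝ (Fin 3) → ℝ := fun z =>
    η z.1 * (H (Φ z.1 z.2) * ‖gradient Θ z.2‖ ^ 2) with hT₁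
  set T₂ : ℝ × EuclideanSpace ℝ (Fin 3) → ℝ := fun z =>
    η z.1 * (H (Φ z.1 z.2) * inner ℝ (U z.1 z.2) (gradient (fun y => Θ y ^ 2) z.2)) with hT₂
  set T₃ : ℝ × EuclideanSpace ℝ (Fin 3) → ℝ := fun z => η z.1 *
    (2 / cylRadius z.2 * (H (Φ z.1 z.2) * fderiv ℝ (fun y => Θ y ^ 2) z.2 (eR z.2))) with hT₃
  set T₄ : ℝ × EuclideanSpace ℝ (Fin 3) → ℝ := fun z =>
    |deriv η z.1| * (H (Φ z.1 z.2) * Θ z.2 ^ 2) with hT₄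
  set d₁ : ℝ := 8 * l ^ 3 * A ^ 2 with hd₁
  set c₂ : ℝ := 8 * l ^ 3 * (2 * A) with hc₂
  set c₃ : ℝ := 8 * l ^ 3 * (4 * A) with hc₃
  have hd₁0 : 0 ≤ d₁ := by positivity
  have hc₂0 : 0 ≤ c₂ := by positivity
  have hc₃0 : 0 ≤ c₃ := by positivity
  have hηz : ∀ s, η s = 1 := fun _ => rfl
  have hdη : ∀ s, deriv η s = 0 := fun s => by rw [hη]; exact deriv_const s 1
  set KK : Set (ℝ × EuclideanSpace ℝ (Fin 3)) := (univ : Set ℝ) ×ˢ K with hKK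
  have hKKm : MeasurableSet KK := MeasurableSet.univ.prod hKm
  have hmemKK : ∀ z : ℝ × EuclideanSpace ℝ (Fin 3), z ∈ KK ↔ z.2 ∈ K := fun z => by
    simp [hKK]
  have hT₄0 : ∀ z, T₄ z = 0 := fun z => by
    show |deriv η z.1| * (H (Φ z.1 z.2) * Θ z.2 ^ 2) = 0
    rw [hdη, abs_zero, zero_mul]
  have hHle : ∀ z : ℝ × EuclideanSpace ℝ (Fin 3), H (Φ z.1 z.2) ≤ 8 * l ^ 3 := fun z => hH8 _ (hΦ0 _ _)
  have hHnn : ∀ z : ℝ × EuclideanSpace ℝ (Fin 3), 0 ≤ H (Φ z.1 z.2) := fun z => hH0 _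
  have hgΘ : ∀ x, ‖gradient Θ x‖ ≤ A := fun x => by rw [norm_gradient_eq_norm_fderiv]; exact hΘA _
  have hgΘ2 : ∀ x, ‖gradient (fun y => Θ y ^ 2) x‖ ≤ 2 * A := fun x => by
    refine (norm_gradient_sq_le hΘ1 x).trans ?_
    have h1 : |Θ x| ≤ 1 := by rw [abs_of_nonneg (hΘ01 x).1]; exact (hΘ01 x).2
    calc 2 * |Θ x| * ‖fderiv ℝ Θ x‖ ≤ 2 * 1 * A := by gcongr; exact hΘA _
      _ = 2 * A := by ring
  have hdΘ2 : ∀ x, |fderiv ℝ (fun y => Θ y ^ 2) x (eR x)| ≤ 2 * A := fun x => by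
    rw [fderiv_sq_apply hΘ1, abs_mul, abs_mul, abs_two, abs_of_nonneg (hΘ01 x).1]
    have h1 : |fderiv ℝ Θ x (eR x)| ≤ A := by
      have h := ContinuousLinearMap.le_opNorm (fderiv ℝ Θ x) (eR x)
      rw [Real.norm_eq_abs] at h
      calc |fderiv ℝ Θ x (eR x)| ≤ ‖fderiv ℝ Θ x‖ * ‖eR x‖ := h
        _ ≤ A * 1 := by gcongr; exacts [hΘA _, norm_eR_le_one _]
        _ = A := mul_one A
    calc 2 * Θ x * |fderiv ℝ Θ x (eR x)| ≤ 2 * 1 * A := by gcongr; exact (hΘ01 x).2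
      _ = 2 * A := by ring
  have hB₁ : ∀ z, ‖T₁ z‖ₑ ≤ KK.indicator (fun _ => ENNReal.ofReal d₁) z := by
    intro z
    by_cases hz : z.2 ∈ K
    · rw [indicator_of_mem ((hmemKK z).2 hz)]
      have hreal : |T₁ z| ≤ d₁ := by
        show |η z.1 * (H (Φ z.1 z.2) * ‖gradient Θ z.2‖ ^ 2)| ≤ d₁
        rw [hηz z.1, one_mul, abs_of_nonneg (mul_nonneg (hHnn z) (sq_nonneg _)), hd₁]
        have : ‖gradient Θ z.2‖ ^ 2 ≤ A ^ 2 := pow_le_pow_left₀ (norm_nonneg _) (hgΘ _) 2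
        nlinarith [mul_le_mul (hHle z) this (sq_nonneg _) (by positivity)]
      rw [Real.enorm_eq_ofReal_abs]; exact ENNReal.ofReal_le_ofReal hreal
    · obtain ⟨-, hdΘ0, -⟩ := hΘzero z.2 hz
      have hg1 : gradient Θ z.2 = 0 := by unfold gradient; rw [hdΘ0]; simp
      have : T₁ z = 0 := by
        show η z.1 * (H (Φ z.1 z.2) * ‖gradient Θ z.2‖ ^ 2) = 0
        rw [hg1]; simp
      rw [this, enorm_zero]; exact zero_le
  have hB₂ : ∀ z, ‖T₂ z‖ₑ ≤ KK.indicator (fun z => ENNReal.ofReal c₂ * ‖U z.1 z.2‖ₑ) z := by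
    intro z
    by_cases hz : z.2 ∈ K
    · rw [indicator_of_mem ((hmemKK z).2 hz)]
      have hreal : |T₂ z| ≤ c₂ * ‖U z.1 z.2‖ := by
        show |η z.1 * (H (Φ z.1 z.2) * inner ℝ (U z.1 z.2) (gradient (fun y => Θ y ^ 2) z.2))| ≤ _
        rw [hηz z.1, one_mul, abs_mul, abs_of_nonneg (hHnn z), hc₂]
        have hin : |inner ℝ (U z.1 z.2) (gradient (fun y => Θ y ^ 2) z.2)| ≤ ‖U z.1 z.2‖ * (2 * A) :=
          (abs_real_inner_le_norm _ _).trans (mul_le_mul_of_nonneg_left (hgΘ2 _) (norm_nonneg _))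
        calc H (Φ z.1 z.2) * |inner ℝ (U z.1 z.2) (gradient (fun y => Θ y ^ 2) z.2)|
            ≤ 8 * l ^ 3 * (‖U z.1 z.2‖ * (2 * A)) :=
              mul_le_mul (hHle z) hin (abs_nonneg _) (by positivity)
          _ = 8 * l ^ 3 * (2 * A) * ‖U z.1 z.2‖ := by ring
      calc ‖T₂ z‖ₑ = ENNReal.ofReal |T₂ z| := by rw [← Real.enorm_eq_ofReal_abs]
        _ ≤ ENNReal.ofReal (c₂ * ‖U z.1 z.2‖) := ENNReal.ofReal_le_ofReal hreal
        _ = ENNReal.ofReal c₂ * ‖U z.1 z.2‖ₑ := by rw [ENNReal.ofReal_mul hc₂0, ofReal_norm]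
    · obtain ⟨-, -, hg2⟩ := hΘzero z.2 hz
      have : T₂ z = 0 := by
        show η z.1 * (H (Φ z.1 z.2) * inner ℝ (U z.1 z.2) (gradient (fun y => Θ y ^ 2) z.2)) = 0
        rw [hg2]; simp
      rw [this, enorm_zero]; exact zero_le
  have hB₃ : ∀ z, ‖T₃ z‖ₑ ≤
      KK.indicator (fun z => ENNReal.ofReal c₃ * ENNReal.ofReal (cylRadius z.2)⁻¹) z := by
    intro z
    by_cases hz : z.2 ∈ K
    · rw [indicator_of_mem ((hmemKK z).2 hz)]
      have hρinv : 0 ≤ (cylRadius z.2)⁻¹ := inv_nonneg.2 (cylRadius_nonneg _)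
      have h2ρ : |2 / cylRadius z.2| = 2 * (cylRadius z.2)⁻¹ := by
        rw [div_eq_mul_inv, abs_mul, abs_two, abs_of_nonneg hρinv]
      have hreal : |T₃ z| ≤ c₃ * (cylRadius z.2)⁻¹ := by
        show |η z.1 * (2 / cylRadius z.2 *
          (H (Φ z.1 z.2) * fderiv ℝ (fun y => Θ y ^ 2) z.2 (eR z.2)))| ≤ _
        rw [hηz z.1, one_mul, abs_mul, h2ρ, abs_mul, abs_of_nonneg (hHnn z), hc₃]
        have : H (Φ z.1 z.2) * |fderiv ℝ (fun y => Θ y ^ 2) z.2 (eR z.2)| ≤ 8 * l ^ 3 * (2 * A) :=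
          mul_le_mul (hHle z) (hdΘ2 _) (abs_nonneg _) (by positivity)
        calc 2 * (cylRadius z.2)⁻¹ * (H (Φ z.1 z.2) * |fderiv ℝ (fun y => Θ y ^ 2) z.2 (eR z.2)|)
            ≤ 2 * (cylRadius z.2)⁻¹ * (8 * l ^ 3 * (2 * A)) :=
              mul_le_mul_of_nonneg_left this (by positivity)
          _ = 8 * l ^ 3 * (4 * A) * (cylRadius z.2)⁻¹ := by ring
      calc ‖T₃ z‖ₑ = ENNReal.ofReal |T₃ z| := by rw [← Real.enorm_eq_ofReal_abs]
        _ ≤ ENNReal.ofReal (c₃ * (cylRadius z.2)⁻¹) := ENNReal.ofReal_le_ofReal hreal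
        _ = ENNReal.ofReal c₃ * ENNReal.ofReal (cylRadius z.2)⁻¹ := by rw [ENNReal.ofReal_mul hc₃0]
    · obtain ⟨hΘ0', -, -⟩ := hΘzero z.2 hz
      have : T₃ z = 0 := by
        show η z.1 * (2 / cylRadius z.2 *
          (H (Φ z.1 z.2) * fderiv ℝ (fun y => Θ y ^ 2) z.2 (eR z.2))) = 0
        rw [fderiv_sq_apply hΘ1, hΘ0']; simp
      rw [this, enorm_zero]; exact zero_le
  have hIcc_sub : ∀ t₂, t₂ < t₀ → Icc a t₂ ×ˢ K ⊆
      Ioo (-R ^ 2) 0 ×ˢ ball (0 : EuclideanSpace ℝ (Fin 3)) (2 * R) := by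
    intro t₂ ht₂
    refine prod_mono (fun s hs => ⟨ha.trans_le hs.1, hs.2.trans_lt (ht₂.trans_le ht₀)⟩)
      (closedBall_subset_ball hρ₁R)
  have hUe : ∀ t₂, t₂ < t₀ → AEMeasurable (fun z : ℝ × EuclideanSpace ℝ (Fin 3) => ‖U z.1 z.2‖ₑ)
      (volume.restrict (Icc a t₂ ×ˢ K)) := by
    intro t₂ ht₂
    exact (hU.mono_measure (Measure.restrict_mono (hIcc_sub t₂ ht₂) le_rfl)).enorm
  have hρm : Measurable fun z : ℝ × EuclideanSpace ℝ (Fin 3) =>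
      ENNReal.ofReal (cylRadius z.2)⁻¹ :=
    ENNReal.measurable_ofReal.comp ((continuous_cylRadius.measurable.comp measurable_snd).inv)
  have hrestr : ∀ t₂, (volume.restrict (Icc a t₂ ×ˢ (univ : Set (EuclideanSpace ℝ (Fin 3))))).restrict KK
      = volume.restrict (Icc a t₂ ×ˢ K) := fun t₂ => by
    rw [Measure.restrict_restrict hKKm, hKK, prod_inter_prod, univ_inter, inter_univ]
  have hvolK : ∀ t₂, t₂ < t₀ → volume (Icc a t₂ ×ˢ K) ≤ ENNReal.ofReal (t₀ - a) * volume K := by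
    intro t₂ ht₂
    calc volume (Icc a t₂ ×ˢ K) ≤ volume (Icc a t₀ ×ˢ K) :=
          measure_mono (prod_mono (Icc_subset_Icc le_rfl ht₂.le) le_rfl)
      _ = ENNReal.ofReal (t₀ - a) * volume K := by
          rw [Measure.volume_eq_prod, Measure.prod_prod, Real.volume_Icc]
  have hI₁ : ∀ t₂, t₂ < t₀ →
      ∫⁻ z in Icc a t₂ ×ˢ (univ : Set (EuclideanSpace ℝ (Fin 3))), ‖T₁ z‖ₑ ≤
        ENNReal.ofReal d₁ * (ENNReal.ofReal (t₀ - a) * volume K) := by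
    intro t₂ ht₂
    calc ∫⁻ z in Icc a t₂ ×ˢ (univ : Set (EuclideanSpace ℝ (Fin 3))), ‖T₁ z‖ₑ
        ≤ ∫⁻ z in Icc a t₂ ×ˢ (univ : Set (EuclideanSpace ℝ (Fin 3))),
            KK.indicator (fun _ => ENNReal.ofReal d₁) z := lintegral_mono fun z => hB₁ z
      _ = ENNReal.ofReal d₁ * volume (Icc a t₂ ×ˢ K) := by
          rw [lintegral_indicator_const hKKm, Measure.restrict_apply hKKm, hKK, prod_inter_prod,
            univ_inter, inter_univ]
      _ ≤ _ := mul_le_mul' le_rfl (hvolK t₂ ht₂)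
  have hI₂ : ∀ t₂, t₂ < t₀ →
      ∫⁻ z in Icc a t₂ ×ˢ (univ : Set (EuclideanSpace ℝ (Fin 3))), ‖T₂ z‖ₑ ≤
        ENNReal.ofReal c₂ * IU := by
    intro t₂ ht₂
    have hsubt : Icc a t₂ ×ˢ K ⊆ Ico a t₀ ×ˢ K := prod_mono (Icc_subset_Ico_right ht₂) le_rfl
    calc ∫⁻ z in Icc a t₂ ×ˢ (univ : Set (EuclideanSpace ℝ (Fin 3))), ‖T₂ z‖ₑ
        ≤ ∫⁻ z in Icc a t₂ ×ˢ (univ : Set (EuclideanSpace ℝ (Fin 3))),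
            KK.indicator (fun z => ENNReal.ofReal c₂ * ‖U z.1 z.2‖ₑ) z := lintegral_mono fun z => hB₂ z
      _ = ∫⁻ z in Icc a t₂ ×ˢ K, ENNReal.ofReal c₂ * ‖U z.1 z.2‖ₑ := by
          rw [lintegral_indicator hKKm, hrestr t₂]
      _ = ENNReal.ofReal c₂ * ∫⁻ z in Icc a t₂ ×ˢ K, ‖U z.1 z.2‖ₑ :=
          lintegral_const_mul'' _ (hUe t₂ ht₂)
      _ ≤ ENNReal.ofReal c₂ * IU := mul_le_mul' le_rfl ((lintegral_mono_set hsubt).trans hIU)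
  have hI₃ : ∀ t₂, t₂ < t₀ →
      ∫⁻ z in Icc a t₂ ×ˢ (univ : Set (EuclideanSpace ℝ (Fin 3))), ‖T₃ z‖ₑ ≤
        ENNReal.ofReal c₃ * Iϱ := by
    intro t₂ ht₂
    have hsubt : Icc a t₂ ×ˢ K ⊆ Ico a t₀ ×ˢ K := prod_mono (Icc_subset_Ico_right ht₂) le_rfl
    calc ∫⁻ z in Icc a t₂ ×ˢ (univ : Set (EuclideanSpace ℝ (Fin 3))), ‖T₃ z‖ₑ
        ≤ ∫⁻ z in Icc a t₂ ×ˢ (univ : Set (EuclideanSpace ℝ (Fin 3))),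
            KK.indicator (fun z => ENNReal.ofReal c₃ * ENNReal.ofReal (cylRadius z.2)⁻¹) z :=
          lintegral_mono fun z => hB₃ z
      _ = ∫⁻ z in Icc a t₂ ×ˢ K, ENNReal.ofReal c₃ * ENNReal.ofReal (cylRadius z.2)⁻¹ := by
          rw [lintegral_indicator hKKm, hrestr t₂]
      _ = ENNReal.ofReal c₃ * ∫⁻ z in Icc a t₂ ×ˢ K, ENNReal.ofReal (cylRadius z.2)⁻¹ :=
          lintegral_const_mul _ hρm
      _ ≤ ENNReal.ofReal c₃ * Iϱ := mul_le_mul' le_rfl ((lintegral_mono_set hsubt).trans hIϱ)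
  set Btot : ℝ := 8 * l ^ 3 * VK + 4 * d₁ * ((t₀ - a) * VK) + c₂ * IU.toReal + c₃ * Iϱ.toReal
    with hBtot
  have hMa : ∫ x, H (Φ a x) * Θ x ^ 2 ≤ 8 * l ^ 3 * VK := by
    refine integral_le_of_le_indicator_const hKm hKfin.ne (by positivity) (fun x _ => ?_)
      (fun x hx => by rw [(hΘzero x hx).1]; simp)
    rw [abs_of_nonneg (mul_nonneg (hH0 _) (sq_nonneg _))]
    have hΘsq : Θ x ^ 2 ≤ 1 := by have := hΘ01 x; nlinarith
    calc H (Φ a x) * Θ x ^ 2 ≤ 8 * l ^ 3 * 1 :=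
        mul_le_mul (hH8 _ (hΦ0 _ _)) hΘsq (sq_nonneg _) (by positivity)
      _ = 8 * l ^ 3 := mul_one _
  have hreal_of_lintegral : ∀ (T : ℝ × EuclideanSpace ℝ (Fin 3) → ℝ) (t₂ : ℝ) (B : ℝ≥0∞),
      B ≠ ∞ → ∫⁻ z in Icc a t₂ ×ˢ (univ : Set (EuclideanSpace ℝ (Fin 3))), ‖T z‖ₑ ≤ B →
      (∫ z in Icc a t₂ ×ˢ (univ : Set (EuclideanSpace ℝ (Fin 3))), T z) ≤ B.toReal := by
    intro T t₂ B hB hle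
    have h1 := norm_integral_le_lintegral_norm
      (μ := volume.restrict (Icc a t₂ ×ˢ (univ : Set (EuclideanSpace ℝ (Fin 3))))) T
    have h2 : ∫⁻ z in Icc a t₂ ×ˢ (univ : Set (EuclideanSpace ℝ (Fin 3))), ENNReal.ofReal ‖T z‖ ≤ B := by
      refine (lintegral_mono fun z => ?_).trans hle
      rw [ofReal_norm]
    exact (Real.le_norm_self _).trans (h1.trans (ENNReal.toReal_mono hB h2))
  have hstep : ∀ t₂, a ≤ t₂ → t₂ < t₀ →
      ENNReal.ofReal (3 * l) *
          ∫⁻ z in (Icc a t₂ ×ˢ ball (0 : EuclideanSpace ℝ (Fin 3)) ρ) ∩ {z | Φ z.1 z.2 < l},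
            ‖fderiv ℝ (Φ z.1) z.2‖ₑ ^ 2 ≤ ENNReal.ofReal Btot := by
    intro t₂ hat₂ ht₂
    have ht₂0 : t₂ < 0 := ht₂.trans_le ht₀
    have h' := hEC H hH2 hH' hH0 hH'' hHsq hHk Θ hΘ1 hΘc hΘsupp η hη1 hη0 a t₂ ha hat₂ ht₂0
    have h : ENNReal.ofReal (η t₂ * ∫ x, H (Φ t₂ x) * Θ x ^ 2) +
        ∫⁻ z in Icc a t₂ ×ˢ (univ : Set (EuclideanSpace ℝ (Fin 3))), ENNReal.ofReal
          (1 / 2 * η z.1 * (deriv (deriv H) (Φ z.1 z.2) * ‖gradient (Φ z.1) z.2‖ ^ 2 *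
            Θ z.2 ^ 2)) ≤
        ENNReal.ofReal (η a * (∫ x, H (Φ a x) * Θ x ^ 2) +
          (4 * ∫ z in Icc a t₂ ×ˢ (univ : Set (EuclideanSpace ℝ (Fin 3))), T₁ z) +
          (∫ z in Icc a t₂ ×ˢ (univ : Set (EuclideanSpace ℝ (Fin 3))), T₂ z) +
          (∫ z in Icc a t₂ ×ˢ (univ : Set (EuclideanSpace ℝ (Fin 3))), T₃ z) +
          (∫ z in Icc a t₂ ×ˢ (univ : Set (EuclideanSpace ℝ (Fin 3))), T₄ z)) := by
      simpa only [hT₁, hT₂, hT₃, hT₄] using h'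
    set St : Set (ℝ × EuclideanSpace ℝ (Fin 3)) :=
      (Icc a t₂ ×ˢ ball (0 : EuclideanSpace ℝ (Fin 3)) ρ) ∩ {z | Φ z.1 z.2 < l} with hSt
    have hStm : MeasurableSet St :=
      (measurableSet_Icc.prod measurableSet_ball).inter
        (measurableSet_lt hΦm measurable_const)
    have hD : ENNReal.ofReal (3 * l) * ∫⁻ z in St, ‖fderiv ℝ (Φ z.1) z.2‖ₑ ^ 2 ≤
        ∫⁻ z in Icc a t₂ ×ˢ (univ : Set (EuclideanSpace ℝ (Fin 3))), ENNReal.ofReal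
          (1 / 2 * η z.1 * (deriv (deriv H) (Φ z.1 z.2) * ‖gradient (Φ z.1) z.2‖ ^ 2 *
            Θ z.2 ^ 2)) := by
      rw [← lintegral_const_mul' _ _ ENNReal.ofReal_ne_top]
      refine (setLIntegral_mono' hStm fun z hz => ?_).trans
        (lintegral_mono_set (inter_subset_left.trans (prod_mono le_rfl (subset_univ _))))
      have hΘ1' : Θ z.2 = 1 := hΘone z.2 hz.1.2
      have hH6' : 6 * l ≤ deriv (deriv H) (Φ z.1 z.2) := hH6 _ (le_of_lt hz.2)
      rw [hηz z.1, hΘ1', norm_gradient_eq_norm_fderiv, ← ofReal_norm,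
        ← ENNReal.ofReal_pow (norm_nonneg _), ← ENNReal.ofReal_mul (by positivity)]
      refine ENNReal.ofReal_le_ofReal ?_
      have hg0 : 0 ≤ ‖fderiv ℝ (Φ z.1) z.2‖ ^ 2 := sq_nonneg _
      nlinarith
    have hR : η a * (∫ x, H (Φ a x) * Θ x ^ 2) +
        (4 * ∫ z in Icc a t₂ ×ˢ (univ : Set (EuclideanSpace ℝ (Fin 3))), T₁ z) +
        (∫ z in Icc a t₂ ×ˢ (univ : Set (EuclideanSpace ℝ (Fin 3))), T₂ z) +
        (∫ z in Icc a t₂ ×ˢ (univ : Set (EuclideanSpace ℝ (Fin 3))), T₃ z) +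
        (∫ z in Icc a t₂ ×ˢ (univ : Set (EuclideanSpace ℝ (Fin 3))), T₄ z) ≤ Btot := by
      rw [hηz a, one_mul]
      have e1 := hreal_of_lintegral T₁ t₂ _
        (ENNReal.mul_ne_top ENNReal.ofReal_ne_top (ENNReal.mul_ne_top ENNReal.ofReal_ne_top hKfin.ne))
        (hI₁ t₂ ht₂)
      have e2 := hreal_of_lintegral T₂ t₂ _ (ENNReal.mul_ne_top ENNReal.ofReal_ne_top hIUfin) (hI₂ t₂ ht₂)
      have e3 := hreal_of_lintegral T₃ t₂ _ (ENNReal.mul_ne_top ENNReal.ofReal_ne_top hIϱfin) (hI₃ t₂ ht₂)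
      rw [ENNReal.toReal_mul, ENNReal.toReal_mul, ENNReal.toReal_ofReal hd₁0,
        ENNReal.toReal_ofReal hta.le, ← hVK] at e1
      rw [ENNReal.toReal_mul, ENNReal.toReal_ofReal hc₂0] at e2
      rw [ENNReal.toReal_mul, ENNReal.toReal_ofReal hc₃0] at e3
      have e4 : (∫ z in Icc a t₂ ×ˢ (univ : Set (EuclideanSpace ℝ (Fin 3))), T₄ z) = 0 := by
        simp only [hT₄0, integral_zero]
      rw [hBtot]
      linarith [hMa, e1, e2, e3, e4]
    calc ENNReal.ofReal (3 * l) * ∫⁻ z in St, ‖fderiv ℝ (Φ z.1) z.2‖ₑ ^ 2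
        ≤ _ := hD
      _ ≤ ENNReal.ofReal (η t₂ * ∫ x, H (Φ t₂ x) * Θ x ^ 2) +
          ∫⁻ z in Icc a t₂ ×ˢ (univ : Set (EuclideanSpace ℝ (Fin 3))), ENNReal.ofReal
            (1 / 2 * η z.1 * (deriv (deriv H) (Φ z.1 z.2) * ‖gradient (Φ z.1) z.2‖ ^ 2 *
              Θ z.2 ^ 2)) := le_add_self
      _ ≤ _ := h
      _ ≤ ENNReal.ofReal Btot := ENNReal.ofReal_le_ofReal hR
  obtain ⟨htn, hcover⟩ := setLIntegral_Ioo_prod_inter_le_iSup hat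
    (ball (0 : EuclideanSpace ℝ (Fin 3)) ρ) {z | Φ z.1 z.2 < l}
    (fun z => ‖fderiv ℝ (Φ z.1) z.2‖ₑ ^ 2)
  have hsup : ENNReal.ofReal (3 * l) *
      ∫⁻ z in (Ioo a t₀ ×ˢ ball (0 : EuclideanSpace ℝ (Fin 3)) ρ) ∩ {z | Φ z.1 z.2 < l},
        ‖fderiv ℝ (Φ z.1) z.2‖ₑ ^ 2 ≤ ENNReal.ofReal Btot := by
    refine (mul_le_mul' le_rfl hcover).trans ?_
    rw [ENNReal.mul_iSup]
    exact iSup_le fun n => hstep _ (htn n).1 (htn n).2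
  have h3l : ENNReal.ofReal (3 * l) ≠ 0 := (ENNReal.ofReal_pos.2 (by positivity)).ne'
  have hBtot_eq : (3 * l)⁻¹ * Btot = 8 / 3 * l ^ 2 * (VK + 4 * A ^ 2 * ((t₀ - a) * VK) +
      2 * A * IU.toReal + 4 * A * Iϱ.toReal) := by
    have hY : Btot = 8 * l ^ 3 * (VK + 4 * A ^ 2 * ((t₀ - a) * VK) +
        2 * A * IU.toReal + 4 * A * Iϱ.toReal) := by
      rw [hBtot, hd₁, hc₂, hc₃]; ring
    have hl3 : (3 * l)⁻¹ * (8 * l ^ 3) = 8 / 3 * l ^ 2 := by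
      field_simp
    rw [hY, ← mul_assoc, hl3]
  calc ∫⁻ z in (Ioo a t₀ ×ˢ ball (0 : EuclideanSpace ℝ (Fin 3)) ρ) ∩ {z | Φ z.1 z.2 < l},
        ‖fderiv ℝ (Φ z.1) z.2‖ₑ ^ 2
      = (ENNReal.ofReal (3 * l))⁻¹ * (ENNReal.ofReal (3 * l) *
          ∫⁻ z in (Ioo a t₀ ×ˢ ball (0 : EuclideanSpace ℝ (Fin 3)) ρ) ∩ {z | Φ z.1 z.2 < l},
            ‖fderiv ℝ (Φ z.1) z.2‖ₑ ^ 2) := by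
        rw [← mul_assoc, ENNReal.inv_mul_cancel h3l ENNReal.ofReal_ne_top, one_mul]
    _ ≤ (ENNReal.ofReal (3 * l))⁻¹ * ENNReal.ofReal Btot := mul_le_mul' le_rfl hsup
    _ = ENNReal.ofReal ((3 * l)⁻¹ * Btot) := by
        rw [← ENNReal.ofReal_inv_of_pos (by positivity), ← ENNReal.ofReal_mul (by positivity)]
    _ = _ := by rw [hBtot_eq]

end Summit.NavierStokesRegularity.NavierStokesRegularity.Theorems.AxisymmetricKatoGlobal.EulerScaling

end
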